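import Literature.Analysis.FluidPDE.BeltramiWaves
import Literature.Analysis.FluidPDE.OnsagerBDSVGluing
import HarnessLib

/-!
# Beltrami waves on `T³`: the `curl` eigen-property and the mean tensor
  (Buckmaster–Vicol 2019, Prop. 3.1; Luo–Titi 2020, Prop. 1 — second half)

Analysis/FluidPDE support file, continuation of `BeltramiWaves` (the field
`W = beltramiField n a = ∑_{ξ∈Λ} a_ξ B_ξ e_{λξ}`, `λ = 5n`, on the unit torus `T³`). Proved here,
for T. Luo, E. S. Titi, Calc. Var. PDE 59 (2020) = arXiv:1808.07595, §3.2, Prop. 1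
(= Buckmaster–Vicol, Ann. of Math. 189 (2019), Prop. 3.1):

* `crossProduct_kvec_bvec` — `(λξ) × B_ξ = -i λ B_ξ` (from `ξ × A_ξ = cdir`,
  `ξ × (ξ × A_ξ) = -A_ξ`), the algebra behind "`B_ξ` is an eigenvector of `iξ × ·`";
* `curl_realTrigPoly` — the curl (`BDSV.curl` of `FluidPDE/OnsagerBDSVGluing`, the tree's curl on
  `𝕋³`) of a real trigonometric polynomial: `curl (Re ∑ e_k c_k) = Re ∑ e_k (2πi k × c_k)`;
* **`curl_beltramiField`** — "`∇ × W = λW`", on the unit torus `curl W = 2πλ W` (the factor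
  `2π` is the unit-torus normalisation of `e_{λξ}(x) = e^{2πiλξ·x}`);
* **`integral_mul_beltramiField`** — "`⨍_{𝕋³} W ⊗ W = ½∑_{ξ∈Λ} |a_ξ|² (Id - ξ ⊗ ξ)`",
  entrywise: `∫_{T³} Wᵢ Wⱼ = ½ ∑_ξ |a_ξ|² (δᵢⱼ - ξᵢξⱼ)` for `n ≠ 0` (finite Parseval against the
  coordinate-rearranged field, then the tensor identity `B ⊗ B̄ + B̄ ⊗ B = Id - ξ ⊗ ξ` summed over
  the pairs `±ξ`).

Not here: the identity `∇·(W ⊗ W) = ∇(|W|²/2)` (a consequence of `curl W ∥ W` through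
`(W·∇)W = ∇|W|²/2 - W × curl W`; it is used only in the oscillation estimates of §3.5 and is
left to that layer).

## References

* T. Luo, E. S. Titi, Calc. Var. PDE 59 (2020) = arXiv:1808.07595, §3.2 Prop. 1. [`LuoTiti2020`]
* T. Buckmaster, V. Vicol, Ann. of Math. 189 (2019) = arXiv:1709.10033, §3.1 Prop. 3.1.
  [`BuckmasterVicol2019AnnMath`]
-/

noncomputable section

open Finset UnitAddTorus Complex MeasureTheory
open scoped BigOperators ComplexConjugate RealInnerProductSpace

namespace Literature.Analysis.FluidPDE.IntermittentBeltrami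

open FunctionSpaces FunctionSpaces.Torus FunctionSpaces.EuclideanSpace

local notation "𝕋³" => UnitAddTorus (Fin 3)
local notation "ℂ³" => EuclideanSpace ℂ (Fin 3)
local notation "ℝ³" => EuclideanSpace ℝ (Fin 3)

/-! ## Cross products: `(λξ) × B_ξ = -iλ B_ξ` -/

/-- `ξ × (ξ × A_ξ) = -A_ξ` for `ξ ∈ Λ` (`{ξ, A_ξ, ξ × A_ξ}` orthonormal). [folklore] -/
theorem crossProduct_dir_cdir (y : LIndex) : crossProduct (dir y) (cdir y) = -adir y := by
  obtain ⟨⟨i, b⟩, n⟩ := y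
  funext q
  fin_cases i <;> cases b <;> cases n <;> fin_cases q <;>
    simp [cross_apply, dir, adir, cdir, intDir, intDirPlus, intAdirPlus, intCdirPlus, four] <;> norm_num

/-- Complexification commutes with the cross product. [folklore] -/
theorem crossProduct_ofReal (u v : Fin 3 → ℝ) :
    crossProduct (fun i => (u i : ℂ)) (fun i => (v i : ℂ)) = fun i => ((crossProduct u v i : ℝ) : ℂ) := by
  funext i
  fin_cases i <;> simp [cross_apply]

/-- `B_ξ` as a plain function `Fin 3 → ℂ`: `(√2)⁻¹ (A_ξ + i ξ×A_ξ)`. [folklore] -/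
theorem ofLp_bvec (y : LIndex) : WithLp.ofLp (bvec y) =
    fun i => ((Real.sqrt 2 : ℝ) : ℂ)⁻¹ * (((adir y i : ℝ) : ℂ) + I * ((cdir y i : ℝ) : ℂ)) := rfl

/-- **`ξ × B_ξ = -i B_ξ`** (`ξ × A = ξ×A`, `ξ × (ξ×A) = -A`). [cite: BuckmasterVicol2019AnnMath, Prop. 3.1] -/
theorem crossProduct_dir_bvec (y : LIndex) :
    crossProduct (fun i => ((dir y i : ℝ) : ℂ)) (WithLp.ofLp (bvec y)) = fun i => -I * bvec y i := by
  have hA := crossProduct_ofReal (dir y) (adir y)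
  have hC := crossProduct_ofReal (dir y) (cdir y)
  rw [crossProduct_dir_adir] at hA
  rw [crossProduct_dir_cdir] at hC
  have hsplit : WithLp.ofLp (bvec y) =
      ((Real.sqrt 2 : ℝ) : ℂ)⁻¹ • ((fun i => ((adir y i : ℝ) : ℂ)) + I • fun i => ((cdir y i : ℝ) : ℂ)) := by
    rw [ofLp_bvec]; funext i; simp [smul_eq_mul]
  rw [hsplit, LinearMap.map_smul, LinearMap.map_add, LinearMap.map_smul, hA, hC]
  funext i
  simp only [Pi.smul_apply, Pi.add_apply, Pi.neg_apply, smul_eq_mul, Complex.ofReal_neg]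
  linear_combination (((Real.sqrt 2 : ℝ) : ℂ)⁻¹ * ((cdir y i : ℝ) : ℂ)) * Complex.I_mul_I

/-- **`(λξ) × B_ξ = -iλ B_ξ`**, `λ = 5n`. [cite: BuckmasterVicol2019AnnMath, Prop. 3.1] -/
theorem crossProduct_kvec_bvec (n : ℤ) (y : LIndex) :
    crossProduct (fun i => ((kvec n y i : ℤ) : ℂ)) (WithLp.ofLp (bvec y)) =
      fun i => -I * (5 * n : ℂ) * bvec y i := by
  have hk : (fun i => ((kvec n y i : ℤ) : ℂ)) = (5 * n : ℂ) • fun i => ((dir y i : ℝ) : ℂ) := by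
    funext i
    have := kvec_cast n y i
    simp only [Pi.smul_apply, smul_eq_mul]
    rw [← Complex.ofReal_intCast, this]
    push_cast
    ring
  rw [hk, LinearMap.map_smul₂, crossProduct_dir_bvec]
  funext i
  simp only [Pi.smul_apply, smul_eq_mul]
  ring

/-! ## The curl of a real trigonometric polynomial -/

/-- The curl coefficients: `c_k ↦ 2πi (k × c_k)`. [folklore] -/
def curlCoeff (c : (Fin 3 → ℤ) → ℂ³) (k : Fin 3 → ℤ) : ℂ³ :=
  WithLp.toLp 2 fun i => (2 * Real.pi * I) * crossProduct (fun j => ((k j : ℤ) : ℂ)) (WithLp.ofLp (c k)) i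

/-- Entries of the curl coefficients. [folklore] -/
theorem curlCoeff_apply (c : (Fin 3 → ℤ) → ℂ³) (k : Fin 3 → ℤ) (i : Fin 3) :
    curlCoeff c k i = (2 * Real.pi * I) * crossProduct (fun j => ((k j : ℤ) : ℂ)) (WithLp.ofLp (c k)) i := rfl

/-- Components of the cross product on `Fin 3 → ℂ`. [folklore] -/
theorem cross_apply_fin (u v : Fin 3 → ℂ) :
    crossProduct u v 0 = u 1 * v 2 - u 2 * v 1 ∧ crossProduct u v 1 = u 2 * v 0 - u 0 * v 2 ∧
      crossProduct u v 2 = u 0 * v 1 - u 1 * v 0 := by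
  refine ⟨?_, ?_, ?_⟩ <;> simp [cross_apply]

/-- Components of `curl` on `𝕋³` in terms of the vector-valued partial derivatives. [folklore] -/
theorem curl_apply_fin (v : 𝕋³ → ℝ³) (x : 𝕋³) :
    BDSV.curl v x 0 = partialDeriv 1 v x 2 - partialDeriv 2 v x 1 ∧
      BDSV.curl v x 1 = partialDeriv 2 v x 0 - partialDeriv 0 v x 2 ∧
        BDSV.curl v x 2 = partialDeriv 0 v x 1 - partialDeriv 1 v x 0 := by
  simp [BDSV.curl]

/-- **The curl of a real trigonometric polynomial**:
`curl (realTrigPoly S c) = realTrigPoly S (k ↦ 2πi (k × c_k))` (`∂ⱼ e_k = 2πi kⱼ e_k`). [folklore] -/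
theorem curl_realTrigPoly (S : Finset (Fin 3 → ℤ)) (c : (Fin 3 → ℤ) → ℂ³) (x : 𝕋³) :
    BDSV.curl (realTrigPoly S c) x = realTrigPoly S (curlCoeff c) x := by
  obtain ⟨h0, h1, h2⟩ := curl_apply_fin (realTrigPoly S c) x
  -- coordinates of the derivative fields and of the curl field
  have hD : ∀ j i : Fin 3, partialDeriv j (realTrigPoly S c) x i =
      (∑ k ∈ S, mFourier k x * ((2 * Real.pi * I * (k j)) * c k i)).re := by
    intro j i
    rw [partialDeriv_realTrigPoly, realTrigPoly_apply_coord, trigPoly_apply_coord]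
    rfl
  have hR : ∀ i : Fin 3, realTrigPoly S (curlCoeff c) x i =
      (∑ k ∈ S, mFourier k x * curlCoeff c k i).re := fun i => by
    rw [realTrigPoly_apply_coord, trigPoly_apply_coord]
  have hc : ∀ k : Fin 3 → ℤ, crossProduct (fun j => ((k j : ℤ) : ℂ)) (WithLp.ofLp (c k)) 0 =
      (k 1 : ℂ) * c k 2 - (k 2 : ℂ) * c k 1 ∧
        crossProduct (fun j => ((k j : ℤ) : ℂ)) (WithLp.ofLp (c k)) 1 = (k 2 : ℂ) * c k 0 - (k 0 : ℂ) * c k 2 ∧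
          crossProduct (fun j => ((k j : ℤ) : ℂ)) (WithLp.ofLp (c k)) 2 = (k 0 : ℂ) * c k 1 - (k 1 : ℂ) * c k 0 :=
    fun k => cross_apply_fin _ _
  ext l
  fin_cases l
  · simp only [Fin.zero_eta]
    rw [h0, hD, hD, hR, ← Complex.sub_re, ← Finset.sum_sub_distrib]
    congr 1
    refine Finset.sum_congr rfl fun k _ => ?_
    rw [curlCoeff_apply, (hc k).1]
    ring
  · simp only [Fin.mk_one]
    rw [h1, hD, hD, hR, ← Complex.sub_re, ← Finset.sum_sub_distrib]
    congr 1
    refine Finset.sum_congr rfl fun k _ => ?_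
    rw [curlCoeff_apply, (hc k).2.1]
    ring
  · simp only [Fin.reduceFinMk]
    rw [h2, hD, hD, hR, ← Complex.sub_re, ← Finset.sum_sub_distrib]
    congr 1
    refine Finset.sum_congr rfl fun k _ => ?_
    rw [curlCoeff_apply, (hc k).2.2]
    ring

/-! ## `curl W = 2πλ W` -/

/-- On `λΛ` the curl coefficients of the Beltrami family are `2πλ` times the coefficients:
`2πi (k × coef k) = 2π(5n) coef k`. [cite: LuoTiti2020, §3.2 Prop. 1] -/
theorem curlCoeff_coef (n : ℤ) (a : LIndex → ℂ) (k : Fin 3 → ℤ) (hk : k ∈ freqSet n) :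
    curlCoeff (coef n a) k = ((2 * Real.pi * (5 * n) : ℝ) : ℂ) • coef n a k := by
  obtain ⟨y₀, -, rfl⟩ := Finset.mem_image.mp hk
  ext i
  rw [curlCoeff_apply, PiLp.smul_apply, smul_eq_mul]
  simp only [coef, WithLp.ofLp_sum, map_sum, Finset.sum_apply, Finset.mul_sum, WithLp.ofLp_smul,
    map_smul, Pi.smul_apply, smul_eq_mul]
  refine Finset.sum_congr rfl fun y hy => ?_
  have hyk : kvec n y = kvec n y₀ := (Finset.mem_filter.mp hy).2
  rw [← hyk, crossProduct_kvec_bvec]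
  push_cast
  linear_combination (-(2 * (Real.pi : ℂ) * (5 * (n : ℂ)) * a y * bvec y i)) * Complex.I_mul_I

/-- Real rescaling of the coefficients rescales the real trigonometric polynomial. [folklore] -/
theorem realTrigPoly_ofReal_smul (S : Finset (Fin 3 → ℤ)) (c : (Fin 3 → ℤ) → ℂ³) (r : ℝ) (x : 𝕋³) :
    realTrigPoly S (fun k => (r : ℂ) • c k) x = r • realTrigPoly S c x := by
  rw [realTrigPoly_apply, realTrigPoly_apply, show (fun k => (r : ℂ) • c k) = (r : ℂ) • c from rfl,
    trigPoly_smul, Pi.smul_apply, Complex.coe_smul, map_smul]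

/-- **Luo–Titi Prop. 1 / BV19 Prop. 3.1: `∇ × W = λW`** — on the unit torus,
`curl W = 2πλ W` for the Beltrami field `W = ∑_ξ a_ξ B_ξ e_{λξ}`, `λ = 5n`.
[cite: LuoTiti2020, §3.2 Prop. 1] -/
theorem curl_beltramiField (n : ℤ) (a : LIndex → ℂ) (x : 𝕋³) :
    BDSV.curl (beltramiField n a) x = (2 * Real.pi * (5 * n) : ℝ) • beltramiField n a x := by
  rw [beltramiField, curl_realTrigPoly, realTrigPoly_congr (curlCoeff_coef n a), realTrigPoly_ofReal_smul]

/-! ## The mean tensor `⨍ W ⊗ W` -/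

/-- The coordinate rearrangement `w ↦ wⱼ eᵢ` on `ℂ³`. [folklore] -/
def qvec (i j : Fin 3) (w : ℂ³) : ℂ³ := EuclideanSpace.single i (w j)

/-- `qvec` commutes with conjugation. [folklore] -/
theorem conjVec_qvec (i j : Fin 3) (w : ℂ³) : conjVec (qvec i j w) = qvec i j (conjVec w) := by
  ext l
  simp only [qvec, conjVec_apply, PiLp.single_apply]
  split_ifs <;> simp

/-- `qvec` is `ℂ`-linear (additive and homogeneous). [folklore] -/
theorem qvec_sum_smul {ι : Type*} (s : Finset ι) (i j : Fin 3) (f : ι → ℂ) (w : ι → ℂ³) :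
    qvec i j (∑ t ∈ s, f t • w t) = ∑ t ∈ s, f t • qvec i j (w t) := by
  ext l
  simp only [qvec, PiLp.single_apply, WithLp.ofLp_sum, Finset.sum_apply, PiLp.smul_apply,
    smul_eq_mul]
  split_ifs <;> simp

/-- The rearranged real trigonometric polynomial is the rearrangement of the original:
`realTrigPoly S (qvec i j ∘ c) x = (realTrigPoly S c x)ⱼ eᵢ`. [folklore] -/
theorem realTrigPoly_qvec (S : Finset (Fin 3 → ℤ)) (c : (Fin 3 → ℤ) → ℂ³) (i j : Fin 3) (x : 𝕋³) :
    realTrigPoly S (fun k => qvec i j (c k)) x = EuclideanSpace.single i (realTrigPoly S c x j) := by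
  ext l
  rw [realTrigPoly_apply_coord, trigPoly_apply, ← qvec_sum_smul, ← trigPoly_apply,
    PiLp.single_apply, realTrigPoly_apply_coord]
  simp only [qvec, PiLp.single_apply]
  split_ifs <;> simp

/-- Conjugate symmetry survives the rearrangement. [folklore] -/
theorem isConjSymm_qvec {c : (Fin 3 → ℤ) → ℂ³} (hc : IsConjSymm c) (i j : Fin 3) :
    IsConjSymm fun k => qvec i j (c k) := fun k => by
  simp only [hc k, conjVec_qvec]

/-- **Products of coordinates of a real trigonometric polynomial integrate by Parseval**:
`∫ (realTrigPoly S c)ᵢ (realTrigPoly S c)ⱼ = ∑_{k∈S} Re ((c k)ⱼ conj (c k)ᵢ)` (conjugate-symmetric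
`c`, symmetric `S`). [folklore] -/
theorem integral_mul_realTrigPoly {S : Finset (Fin 3 → ℤ)} (hS : ∀ k ∈ S, -k ∈ S)
    {c : (Fin 3 → ℤ) → ℂ³} (hc : IsConjSymm c) (i j : Fin 3) :
    ∫ x, realTrigPoly S c x i * realTrigPoly S c x j = ∑ k ∈ S, (c k j * conj (c k i)).re := by
  have h := integral_inner_realTrigPoly_realTrigPoly hS hc (isConjSymm_qvec hc i j)
  have hl : ∀ x, ⟪realTrigPoly S c x, realTrigPoly S (fun k => qvec i j (c k)) x⟫ =
      realTrigPoly S c x i * realTrigPoly S c x j := by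
    intro x
    rw [realTrigPoly_qvec, EuclideanSpace.inner_single_right]
    simp [mul_comm]
  simp_rw [hl] at h
  rw [h]
  refine Finset.sum_congr rfl fun k _ => ?_
  rw [qvec, EuclideanSpace.inner_single_right]

/-- **Luo–Titi Prop. 1 / BV19 Prop. 3.1: `⨍ W ⊗ W = ½ ∑_{ξ∈Λ} |a_ξ|² (Id - ξ ⊗ ξ)`**, entrywise
on the unit torus (probability measure): `∫ Wᵢ Wⱼ = ½ ∑_ξ |a_ξ|² (δᵢⱼ - ξᵢξⱼ)`, for `n ≠ 0` and
coefficients with the reality condition. [cite: LuoTiti2020, §3.2 Prop. 1] -/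
theorem integral_mul_beltramiField {a : LIndex → ℂ} (ha : IsCoefSymm a) {n : ℤ} (hn : n ≠ 0)
    (i j : Fin 3) :
    ∫ x, beltramiField n a x i * beltramiField n a x j =
      (1 / 2 : ℝ) * ∑ y : LIndex, ‖a y‖ ^ 2 * ((if i = j then (1 : ℝ) else 0) - dir y i * dir y j) := by
  have hS : ∀ k ∈ freqSet n, -k ∈ freqSet n := fun _ hk => neg_mem_freqSet hk
  rw [beltramiField, integral_mul_realTrigPoly hS (isConjSymm_coef ha n), freqSet,
    Finset.sum_image fun y _ y' _ h => kvec_injective hn h]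
  -- each term: `|a_ξ|² Re(B_j conj B_i)`
  have hterm : ∀ y : LIndex, (coef n a (kvec n y) j * conj (coef n a (kvec n y) i)).re =
      ‖a y‖ ^ 2 * (bvec y j * conj (bvec y i)).re := by
    intro y
    rw [coef_kvec hn, PiLp.smul_apply, PiLp.smul_apply, smul_eq_mul, smul_eq_mul, map_mul,
      ← Complex.normSq_eq_norm_sq]
    have : a y * bvec y j * (conj (a y) * conj (bvec y i)) =
        (Complex.normSq (a y) : ℂ) * (bvec y j * conj (bvec y i)) := by
      rw [Complex.normSq_eq_conj_mul_self]; ring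
    rw [this, Complex.re_ofReal_mul]
  simp_rw [hterm]
  -- symmetrise over the involution `ξ ↦ -ξ`
  set F : LIndex → ℝ := fun y => ‖a y‖ ^ 2 * (bvec y j * conj (bvec y i)).re with hF
  set G : LIndex → ℝ := fun y => ‖a y‖ ^ 2 * (conj (bvec y j) * bvec y i).re with hG
  have hFG : ∑ y, F y = ∑ y, G y := by
    refine Finset.sum_nbij' (fun y => (y.1, !y.2)) (fun y => (y.1, !y.2)) (fun _ _ => Finset.mem_univ _)
      (fun _ _ => Finset.mem_univ _) (fun y _ => by simp) (fun y _ => by simp) ?_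
    rintro ⟨x, b⟩ -
    simp only [hF, hG, ha x b, bvec_neg, conjVec_apply, Complex.norm_conj, Complex.conj_conj]
  have hsum : ∑ y, F y = (1 / 2 : ℝ) * ∑ y, (F y + G y) := by
    rw [Finset.sum_add_distrib, ← hFG]; ring
  rw [show (∑ y, ‖a y‖ ^ 2 * (bvec y j * conj (bvec y i)).re) = ∑ y, F y from rfl, hsum]
  congr 1
  refine Finset.sum_congr rfl fun y _ => ?_
  simp only [hF, hG, ← mul_add, ← Complex.add_re]
  congr 1
  rw [bvec_mul_conj_add y j i, Complex.ofReal_re]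
  by_cases hij : i = j
  · subst hij; simp
  · simp [hij, Ne.symm hij, mul_comm]

end Literature.Analysis.FluidPDE.IntermittentBeltrami
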